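import Mathlib
import Summits.ResolutionOfSingularities.ResolutionOfSingularities.Theorems.WeightedInvariantLocalWeightedDropNCResSettingDefs

/-!
# `LocalWeightedDrop`, the NC count game — TOT2-LINE piece S-SET (10): **ADMISSIBILITY IS INSENSITIVE TO UNITS; A DRESSED FORM IS ADMISSIBLY
# DECORATED BY ITSELF**

[OURS · L1 W4.3 · chain w43, engine crux `LocalWeightedDrop` stmt-ResolutionOfSingularities-8899; sub-line under the v32 registered stub
`stub_spaceNCRankDrop`, design memo `L/res-L1-w43-lead-1/g4/TOT2-LINE.md` v1 §2, piece S-SET = res-L1-w43-stub-1; objects of `…NCResSettingDefs`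
(p528587); glue for res-L1-w43-stub-2's dressed monic forms `U · P · ∏_{l∈L} x_l` (`…TOT2BridgePoint`, p530471).  Nothing here is a statement
of any manuscript.]

* `Admissible.unit_mul`, `Admissible.mul_unit` — `Admissible b δ → Admissible (U·b) δ` for a unit `U`;
* `Admissible.of_radicalEquiv` — admissibility transports along radical equivalence of positions;
* `admissible_self` — `(f, E, O)` is admissible for its own reduced total equation `f · ∏_{l∈E} x_l` when `f` is squarefree and prime to the letters;
* `admissible_dressed` — hence for every DRESSED FORM `U · (f · ∏_{l∈E} x_l)`, `U` a unit.
-/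

set_option linter.dupNamespace false -- mandated namespace of this single-conjunct summit

noncomputable section

namespace Summit.ResolutionOfSingularities.ResolutionOfSingularities.Theorems

namespace TameFourTupleDrop

open MvPowerSeries Literature.AlgebraicGeometry.Resolution

variable {k : Type} [Field k] {m : ℕ}

/-- ADMISSIBILITY TRANSPORTS ALONG RADICAL EQUIVALENCE of positions. -/
theorem Admissible.of_radicalEquiv {b b' : MvPowerSeries (Fin (m + 1)) k} {δ : Decoration k m} (hadm : Admissible b δ)
    {M N : ℕ} (h₁ : b' ∣ b ^ (M + 1)) (h₂ : b ∣ b' ^ (N + 1)) : Admissible b' δ := by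
  obtain ⟨⟨M₀, N₀, hbT, hTb⟩, hsq, hA3⟩ := hadm
  refine ⟨⟨M * M₀ + M + M₀, N₀ * N + N₀ + N, ?_, ?_⟩, hsq, hA3⟩
  · have h : b ^ (M + 1) ∣ δ.total ^ ((M₀ + 1) * (M + 1)) := by rw [pow_mul]; exact pow_dvd_pow_of_dvd hbT _
    have he : (M₀ + 1) * (M + 1) = M * M₀ + M + M₀ + 1 := by ring
    rw [← he]; exact h₁.trans h
  · have h' : b ^ (N₀ + 1) ∣ (b' ^ (N + 1)) ^ (N₀ + 1) := pow_dvd_pow_of_dvd h₂ _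
    have he : (N + 1) * (N₀ + 1) = N₀ * N + N₀ + N + 1 := by ring
    rw [← he, pow_mul]
    exact hTb.trans h'

/-- Admissibility is insensitive to a unit factor on the left. -/
theorem Admissible.unit_mul {b : MvPowerSeries (Fin (m + 1)) k} {δ : Decoration k m} (hadm : Admissible b δ)
    {U : MvPowerSeries (Fin (m + 1)) k} (hU : IsUnit U) : Admissible (U * b) δ :=
  hadm.of_radicalEquiv (M := 0) (N := 0)
    (by rw [zero_add, pow_one]; obtain ⟨u, rfl⟩ := hU; exact ⟨↑u⁻¹, by rw [mul_comm ↑u b, mul_assoc, Units.mul_inv, mul_one]⟩)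
    (by rw [zero_add, pow_one]; exact dvd_mul_left b U)

/-- Admissibility is insensitive to a unit factor on the right. -/
theorem Admissible.mul_unit {b : MvPowerSeries (Fin (m + 1)) k} {δ : Decoration k m} (hadm : Admissible b δ)
    {U : MvPowerSeries (Fin (m + 1)) k} (hU : IsUnit U) : Admissible (b * U) δ := by
  rw [mul_comm]; exact hadm.unit_mul hU

/-- A unit series: constant coefficient non-zero. -/
theorem isUnit_of_constantCoeff_ne_zero {n : ℕ} {U : MvPowerSeries (Fin n) k} (hU : constantCoeff U ≠ 0) : IsUnit U :=
  isUnit_iff_constantCoeff.mpr (Ne.isUnit hU)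

/-- `(f, E, O)` IS ADMISSIBLE FOR ITS OWN REDUCED TOTAL EQUATION when `f` is squarefree and no boundary letter divides it. -/
theorem admissible_self (δ : Decoration k m) (hsq : Squarefree δ.f) (hA3 : ∀ l ∈ δ.E, ¬ (X l ∣ δ.f)) : Admissible δ.total δ :=
  ⟨⟨0, 0, by rw [zero_add, pow_one], by rw [zero_add, pow_one]⟩, hsq, hA3⟩

/-- **A DRESSED FORM `U · (f · ∏_{l∈E} x_l)` IS ADMISSIBLY DECORATED BY `(f, E, O)`** (`U(0) ≠ 0`, `f` squarefree and prime to the letters; any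
history `O ⊆ E`) — the glue to res-L1-w43-stub-2's dressed monic forms. -/
theorem admissible_dressed (δ : Decoration k m) (hsq : Squarefree δ.f) (hA3 : ∀ l ∈ δ.E, ¬ (X l ∣ δ.f)) {U : MvPowerSeries (Fin (m + 1)) k}
    (hU : constantCoeff U ≠ 0) : Admissible (U * (δ.f * ∏ l ∈ δ.E, X l)) δ :=
  (admissible_self δ hsq hA3).unit_mul (isUnit_of_constantCoeff_ne_zero hU)

end TameFourTupleDrop

end Summit.ResolutionOfSingularities.ResolutionOfSingularities.Theorems

end
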